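import Summits.CriticalPhenomena.SAWScalingLimit.Theorems.SAWTotalPositivityCriticalBubbleBoundJoinMacroDefs
import Summits.CriticalPhenomena.SAWScalingLimit.Theorems.SAWTotalPositivityCriticalBubbleBoundJoinInjection
import Summits.CriticalPhenomena.SAWScalingLimit.Theorems.SAWTotalPositivityCriticalBubbleBoundJoinMacroCards

/-!
# The macroscopic injection input of the join-mass ledger: `D_i ≤ 64 x_c^{-16} Umac_i`
(crux `SAWTotalPositivity.CriticalBubbleBound`, stmt-CriticalPhenomena-7117; line `docking-census-joining`,
registered stub `Dent_le_Umac` of the macroscopic door, lead prover c7)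

The injection `Dent_le_Urar` of the join-mass programme sends every arrow `(n, n', χ¹, χ², k)` of the
entropy mass `Dent i` to the re-rooted Madras join together with its re-rooted junction corner, a GLOBAL
join plaquette of the target class (`joinPoly_reroot`). Here the target is sharpened: the corner is a
MACROSCOPIC global join plaquette (`IsMacroJoin`, `mjoins`, `Umac` of `…JoinMacroDefs`) — the un-joining
flip returns the two sides `τ̃`, `σ̂` of the join, which have exactly `j + 9` and `m + 9` edges
(`joinPoly_sides_card`), each at least a quarter of the `j + m + 18` edges of the join as soon as
`j + 17, m + 17` lie in a common dyadic block; and the decomposition of the flip into two vertex-disjoint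
polygons is unique (`Docking.polygon_pair_unique`), so the quarter bounds hold for THE witnesses of
globalness. Consequently `Dent i ≤ 64 x_c^{-16} Umac i` for `i ≥ 6`, by the proof of `Dent_le_Urar`
verbatim with `gjoins ↦ mjoins`. [cite: Hammond2015SAPJoining, Lemma 4.12]
-/

noncomputable section

open Literature.Probability.LatticeModels
open Literature.Probability.RandomPlanarGeometry Literature.Probability.RandomPlanarGeometry.SAW
open scoped BigOperators
open Summit.CriticalPhenomena.SAWScalingLimit.Theorems.CriticalBubbleBound.Negative (e₀)
open Summit.CriticalPhenomena.SAWScalingLimit.Theorems.CriticalBubbleBound.Docking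

namespace Summit.CriticalPhenomena.SAWScalingLimit.Theorems.CriticalBubbleBound.Join

/-! ## Upgrading a global join plaquette to a macroscopic one -/

/-- **Macroscopic upgrade.** If `q` is a global join plaquette of `P(χ)` and the un-joining flip of
`P(χ)` at `q` is the union of two vertex-disjoint polygons `T`, `S` each carrying at least a quarter of
the `n + 1` edges, then `q` is a MACROSCOPIC global join plaquette: the decomposition of an edge set into
two vertex-disjoint polygons is unique (`Docking.polygon_pair_unique`, applied at an edge through the
root `0`, a vertex of the first global witness), so the global witnesses `E₁ ∋ 0`, `E₂ ⊇ rightCol` are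
`T`, `S` in some order and inherit the two quarter bounds. [cite: Hammond2015SAPJoining, Definition 4.4] -/
theorem isMacroJoin_of_split {n : ℕ} {χ : ℕ → Site 2} {q : Site 2} {T S : Finset (Sym2 (Site 2))}
    (hq : q ∈ gjoins n χ) (hT : IsPolygon (zdGraph 2) T) (hS : IsPolygon (zdGraph 2) S)
    (hd : ∀ x : Site 2, IsV T x → IsV S x → False) (hU : T ∪ S = flipH (pedges n χ) q)
    (hTc : n + 1 ≤ 4 * T.card) (hSc : n + 1 ≤ 4 * S.card) : q ∈ mjoins n χ := by
  obtain ⟨hv, hplaq, E₁, E₂, h₁, h₂, hd', hu, h0, hr⟩ := mem_gjoins.1 hq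
  refine mem_mjoins.2 ⟨hv, hplaq, E₁, E₂, h₁, h₂, hd', hu, h0, hr, ?_⟩
  have hE : E₁ ∪ E₂ = T ∪ S := hu.trans hU.symm
  obtain ⟨e, he, -⟩ := h0
  have he' : e ∈ T ∪ S := hE ▸ Finset.mem_union_left _ he
  rcases Finset.mem_union.1 he' with h | h
  · obtain ⟨rfl, rfl⟩ := polygon_pair_unique h₁ hT hd' hd hE he h
    exact ⟨hTc, hSc⟩
  · have hE' : E₁ ∪ E₂ = S ∪ T := hE.trans (Finset.union_comm _ _)
    obtain ⟨rfl, rfl⟩ := polygon_pair_unique h₁ hS hd' (fun x h1 h2 => hd x h2 h1) hE' he h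
    exact ⟨hSc, hTc⟩

/-- **The re-rooted junction corner of the join is macroscopic.** For an admissible arrow whose two
walk lengths satisfy `m ≤ 3 j + 18`, `j ≤ 3 m + 18` (e.g. `j + 17, m + 17` in a common dyadic block),
re-rooting the Madras join `J` at its lowest-then-leftmost vertex `v` gives a lex-rooted class of walk
length `j + m + 17`, and the translated junction corner `q - v` is a MACROSCOPIC global join plaquette
of it: it is global (`joinPoly_reroot`), its flip is `(τ̃ - v) ∪ (σ̂ - v)` with `#τ̃ = j + 9`,
`#σ̂ = m + 9` (`joinPoly_sides_card`), both `≥ (j + m + 18) / 4`. [cite: Hammond2015SAPJoining, Lemma 4.12] -/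
theorem joinPoly_reroot_macro {j m : ℕ} {χ₁ χ₂ : ℕ → Site 2} {k : ℤ} (hχ₁ : χ₁ ∈ lexRooted j)
    (hχ₂ : χ₂ ∈ lexRooted m) (hj : 3 ≤ j) (hm : 3 ≤ m) (hk : k ∈ offsets j m χ₁ χ₂)
    (hjm : m ≤ 3 * j + 18) (hmj : j ≤ 3 * m + 18) :
    rerootWalk (joinPoly j m χ₁ χ₂ k) (j + m + 17) ∈ lexRooted (j + m + 17) ∧
      rerootSite (joinPoly j m χ₁ χ₂ k) (joinCorner j m χ₁ χ₂ k) ∈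
        mjoins (j + m + 17) (rerootWalk (joinPoly j m χ₁ χ₂ k) (j + m + 17)) := by
  obtain ⟨hJ, hJc, hplaq, hT, hS, hdisj, hflip, hSrow, he₀T, hw, -, -⟩ :=
    joinPoly_spec j m χ₁ χ₂ k hχ₁ hχ₂ hj hm hk
  obtain ⟨hcτ, hcσ⟩ := joinPoly_sides_card j m χ₁ χ₂ k hχ₁ hχ₂ hj hm hk
  obtain ⟨hcls, hpe, hgj⟩ := reroot_of_split hJ hJc hplaq hT hS hdisj hflip hSrow he₀T hw
  have hfl := flipH_trE (-lexMinV (vxs (joinPoly j m χ₁ χ₂ k))) (joinPoly j m χ₁ χ₂ k)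
    (joinCorner j m χ₁ χ₂ k)
  rw [← sub_eq_add_neg] at hfl
  refine ⟨hcls, isMacroJoin_of_split hgj (isPolygon_trE (-lexMinV (vxs (joinPoly j m χ₁ χ₂ k))) hT)
    (isPolygon_trE (-lexMinV (vxs (joinPoly j m χ₁ χ₂ k))) hS) (fun x h1 h2 => ?_) ?_ ?_ ?_⟩
  · rw [isV_trE_iff] at h1 h2
    exact hdisj _ h1 h2
  · rw [← trE_union, ← hflip, hpe, rerootSite, hfl]
  · rw [card_trE_eq, hcτ]
    omega
  · rw [card_trE_eq, hcσ]
    omega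

/-! ## The macroscopic injection bound -/

/-- **Stub `Dent_le_Umac` (the MACROSCOPIC injection input `D_i ≤ 64 μ^16 Umac_i` of the ledger),
scales `i ≥ 6`.** An arrow `(n, n', χ¹, χ², k)` of `Dent i` (`n, n' ∈ B_i`, so `j = n - 17`,
`m = n' - 17 ≥ 3` and `m + 17 < 2^{i+1} ≤ 2 (j + 17)`, whence `m ≤ 3 j + 18` and symmetrically) is
sent to `(n + n', re-rooted join class, re-rooted junction corner, the two case-tag codes)`, an index of
`64 · Umac i` (`joinPoly_reroot_macro`: the class is lex-rooted of walk length `n + n' - 17` and the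
corner is a MACROSCOPIC global join plaquette; the tags are coded in `range 8 × range 8`); the map is
injective (`joinArrow_injective`) and carries the weight `x_c^{(j+1)+(m+1)} = x_c^{-16} · x_c^{(n+n'-17)+1}`;
the remaining terms are nonnegative. The proof is that of `Dent_le_Urar` with `gjoins ↦ mjoins`.
[cite: Hammond2015SAPJoining, Lemma 4.12] -/
theorem Dent_le_Umac : ∀ i : ℕ, 6 ≤ i → Dent i ≤ 64 * criticalFugacity⁻¹ ^ 16 * Umac i := by
  intro i hi
  classical
  have hx0 : 0 < criticalFugacity := criticalFugacity_pos_lt_one'.1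
  have h64 : 64 ≤ 2 ^ i :=
    le_trans (by norm_num) (Nat.pow_le_pow_right (by norm_num) hi)
  have hblk : ∀ n ∈ block i, joinShift ≤ n ∧ 3 ≤ n - joinShift := fun n hn => by
    rw [block, Finset.mem_Ico] at hn
    simp only [joinShift]
    omega
  -- the quarter arithmetic of two lengths in a common block
  have hqrt : ∀ n ∈ block i, ∀ n' ∈ block i, n' - joinShift ≤ 3 * (n - joinShift) + 18 := by
    intro n hn n' hn'
    rw [block, Finset.mem_Ico, pow_succ] at hn hn'
    simp only [joinShift]
    omega
  -- tag codes
  obtain ⟨code, hcode, hcode8⟩ : ∃ code : JCase → ℕ, Function.Injective code ∧ ∀ c, code c < 8 :=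
    ⟨fun c => match c with
      | .Aup => 0 | .Adown => 1 | .B1 => 2 | .B2a => 3 | .B2b => 4 | .C1 => 5 | .C2a => 6 | .C2b => 7,
     fun a b h => by cases a <;> cases b <;> first | rfl | simp at h,
     fun c => by cases c <;> decide⟩
  -- the two index finsets
  set T := (((block i ×ˢ block i).sigma fun nn : ℕ × ℕ =>
      lexRooted (nn.1 - joinShift) ×ˢ lexRooted (nn.2 - joinShift)).sigma
    fun p => offsets (p.1.1 - joinShift) (p.1.2 - joinShift) p.2.1 p.2.2) with hT
  set U := ((((block (i + 1)).filter fun n => joinShift ≤ n).sigma fun n : ℕ =>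
      lexRooted (n - joinShift)).sigma fun p => mjoins (p.1 - joinShift) p.2) ×ˢ
    (Finset.range 8 ×ˢ Finset.range 8) with hU
  have hL : Dent i = ∑ t ∈ T,
      criticalFugacity ^ (t.1.1.1 - joinShift + 1 + (t.1.1.2 - joinShift + 1)) := by
    rw [Dent, hT, Finset.sum_sigma, Finset.sum_sigma, Finset.sum_product]
    refine Finset.sum_congr rfl fun n hn => Finset.sum_congr rfl fun n' hn' => ?_
    rw [if_pos ⟨(hblk n hn).1, (hblk n' hn').1⟩, Finset.sum_product]
    refine Finset.sum_congr rfl fun χ₁ _ => Finset.sum_congr rfl fun χ₂ _ => ?_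
    dsimp only
    rw [Finset.sum_const, nsmul_eq_mul]
  have hR : 64 * criticalFugacity⁻¹ ^ 16 * Umac i =
      ∑ u ∈ U, criticalFugacity⁻¹ ^ 16 * criticalFugacity ^ (u.1.1.1 - joinShift + 1) := by
    rw [hU, Finset.sum_product, Finset.sum_sigma, Finset.sum_sigma, Umac, ← Finset.sum_filter,
      Finset.mul_sum]
    refine Finset.sum_congr rfl fun n _ => ?_
    rw [Finset.mul_sum]
    refine Finset.sum_congr rfl fun χ _ => ?_
    dsimp only
    rw [Finset.sum_const, Finset.sum_const, Finset.card_product, Finset.card_range, smul_smul,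
      nsmul_eq_mul]
    push_cast
    ring
  -- the arrow, as a relation with an image for every index of `Dent i`
  have himg : ∀ t : (_ : (_ : ℕ × ℕ) × ((ℕ → Site 2) × (ℕ → Site 2))) × ℤ,
      ∃ u : ((_ : (_ : ℕ) × (ℕ → Site 2)) × Site 2) × (ℕ × ℕ), t ∈ T →
        u ∈ U ∧
        criticalFugacity ^ (t.1.1.1 - joinShift + 1 + (t.1.1.2 - joinShift + 1)) =
          criticalFugacity⁻¹ ^ 16 * criticalFugacity ^ (u.1.1.1 - joinShift + 1) ∧
        u.1.1.1 = t.1.1.1 + t.1.1.2 ∧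
        u.1.1.2 = rerootWalk (joinPoly (t.1.1.1 - joinShift) (t.1.1.2 - joinShift) t.1.2.1 t.1.2.2 t.2)
          (t.1.1.1 - joinShift + (t.1.1.2 - joinShift) + 17) ∧
        u.1.2 = rerootSite (joinPoly (t.1.1.1 - joinShift) (t.1.1.2 - joinShift) t.1.2.1 t.1.2.2 t.2)
          (joinCorner (t.1.1.1 - joinShift) (t.1.1.2 - joinShift) t.1.2.1 t.1.2.2 t.2) ∧
        u.2 = (code (joinTags (t.1.1.1 - joinShift) (t.1.1.2 - joinShift) t.1.2.1 t.1.2.2 t.2).1,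
          code (joinTags (t.1.1.1 - joinShift) (t.1.1.2 - joinShift) t.1.2.1 t.1.2.2 t.2).2) := by
    rintro ⟨⟨⟨n, n'⟩, χ₁, χ₂⟩, k⟩
    by_cases ht : (⟨⟨(n, n'), (χ₁, χ₂)⟩, k⟩ :
        (_ : (_ : ℕ × ℕ) × ((ℕ → Site 2) × (ℕ → Site 2))) × ℤ) ∈ T
    · have ht' := ht
      simp only [hT, Finset.mem_sigma, Finset.mem_product] at ht'
      obtain ⟨⟨⟨hn, hn'⟩, hχ₁, hχ₂⟩, hk⟩ := ht'
      obtain ⟨h17, h3⟩ := hblk n hn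
      obtain ⟨h17', h3'⟩ := hblk n' hn'
      obtain ⟨hcls, hmj⟩ := joinPoly_reroot_macro hχ₁ hχ₂ h3 h3' hk (hqrt n hn n' hn')
        (hqrt n' hn' n hn)
      have e1 : n + n' - joinShift = n - joinShift + (n' - joinShift) + 17 := by
        simp only [joinShift] at *
        omega
      refine ⟨(⟨⟨n + n', rerootWalk (joinPoly (n - joinShift) (n' - joinShift) χ₁ χ₂ k)
          (n - joinShift + (n' - joinShift) + 17)⟩,
        rerootSite (joinPoly (n - joinShift) (n' - joinShift) χ₁ χ₂ k)
          (joinCorner (n - joinShift) (n' - joinShift) χ₁ χ₂ k)⟩,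
        (code (joinTags (n - joinShift) (n' - joinShift) χ₁ χ₂ k).1,
          code (joinTags (n - joinShift) (n' - joinShift) χ₁ χ₂ k).2)),
        fun _ => ⟨?_, ?_, ?_, ?_, ?_, ?_⟩⟩
      · simp only [hU, Finset.mem_product, Finset.mem_sigma, Finset.mem_filter, Finset.mem_range]
        refine ⟨⟨⟨⟨?_, by omega⟩, ?_⟩, ?_⟩, hcode8 _, hcode8 _⟩
        · rw [block, Finset.mem_Ico, pow_succ] at hn hn'
          rw [block, Finset.mem_Ico, pow_succ, pow_succ]
          omega
        · rw [e1]
          exact hcls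
        · show rerootSite _ _ ∈ mjoins (n + n' - joinShift) _
          rw [e1]
          exact hmj
      · dsimp only
        have e2 : n + n' - joinShift + 1 = n - joinShift + 1 + (n' - joinShift + 1) + 16 := by
          simp only [joinShift] at *
          omega
        rw [e2, pow_add criticalFugacity (n - joinShift + 1 + (n' - joinShift + 1)) 16, mul_left_comm,
          ← mul_pow, inv_mul_cancel₀ hx0.ne', one_pow, mul_one]
      · dsimp only
      · dsimp only
      · dsimp only
      · dsimp only
    · exact ⟨((⟨⟨0, fun _ => 0⟩, 0⟩, (0, 0))), fun h => (ht h).elim⟩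
  choose Φ hΦ using himg
  -- injectivity
  have hinj : Set.InjOn Φ ↑T := by
    rintro ⟨⟨⟨n₁, n₁'⟩, χ₁, χ₂⟩, k₁⟩ ht₁ ⟨⟨⟨n₂, n₂'⟩, η₁, η₂⟩, k₂⟩ ht₂ heq
    rw [Finset.mem_coe] at ht₁ ht₂
    obtain ⟨-, -, hN₁, hW₁, hS₁, hT₁⟩ := hΦ _ ht₁
    obtain ⟨-, -, hN₂, hW₂, hS₂, hT₂⟩ := hΦ _ ht₂
    rw [heq] at hN₁ hW₁ hS₁ hT₁
    simp only [hT, Finset.mem_sigma, Finset.mem_product] at ht₁ ht₂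
    obtain ⟨⟨⟨hn₁, hn₁'⟩, hχ₁, hχ₂⟩, hk₁⟩ := ht₁
    obtain ⟨⟨⟨hn₂, hn₂'⟩, hη₁, hη₂⟩, hk₂⟩ := ht₂
    dsimp only at hN₁ hW₁ hS₁ hT₁ hN₂ hW₂ hS₂ hT₂ hχ₁ hχ₂ hk₁ hη₁ hη₂ hk₂
    obtain ⟨a₁, b₁⟩ := hblk n₁ hn₁
    obtain ⟨a₁', b₁'⟩ := hblk n₁' hn₁'
    obtain ⟨a₂, b₂⟩ := hblk n₂ hn₂
    obtain ⟨a₂', b₂'⟩ := hblk n₂' hn₂'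
    have htags : joinTags (n₁ - joinShift) (n₁' - joinShift) χ₁ χ₂ k₁ =
        joinTags (n₂ - joinShift) (n₂' - joinShift) η₁ η₂ k₂ := by
      have h := hT₁.symm.trans hT₂
      rw [Prod.mk.injEq] at h
      exact Prod.ext (hcode h.1) (hcode h.2)
    obtain ⟨e1, e2, e3, e4, e5⟩ := joinArrow_injective _ _ _ _ _ _ _ _ _ _ hχ₁ hχ₂ b₁ b₁' hk₁
      hη₁ hη₂ b₂ b₂' hk₂ (by omega) (hW₁.symm.trans hW₂) (hS₁.symm.trans hS₂) htags
    have en : n₁ = n₂ := by omega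
    have en' : n₁' = n₂' := by omega
    subst en en' e3 e4 e5
    rfl
  -- the estimate
  set g : ((_ : (_ : ℕ) × (ℕ → Site 2)) × Site 2) × (ℕ × ℕ) → ℝ :=
    fun u => criticalFugacity⁻¹ ^ 16 * criticalFugacity ^ (u.1.1.1 - joinShift + 1) with hg
  have hg0 : ∀ u, 0 ≤ g u := fun u =>
    mul_nonneg (pow_nonneg (inv_nonneg.2 hx0.le) _) (pow_nonneg hx0.le _)
  have hstep1 : Dent i = ∑ t ∈ T, g (Φ t) := by
    rw [hL]
    exact Finset.sum_congr rfl fun t ht => (hΦ t ht).2.1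
  have hstep2 : ∑ u ∈ T.image Φ, g u = ∑ t ∈ T, g (Φ t) := Finset.sum_image hinj
  have hsub : T.image Φ ⊆ U := Finset.image_subset_iff.2 fun t ht => (hΦ t ht).1
  have hstep3 : ∑ u ∈ T.image Φ, g u ≤ ∑ u ∈ U, g u :=
    Finset.sum_le_sum_of_subset_of_nonneg hsub fun u _ _ => hg0 u
  have hR' : 64 * criticalFugacity⁻¹ ^ 16 * Umac i = ∑ u ∈ U, g u := hR
  rw [hstep1, ← hstep2, hR']
  exact hstep3

end Summit.CriticalPhenomena.SAWScalingLimit.Theorems.CriticalBubbleBound.Join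

end
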